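import Literature.NumberTheory.EllipticCurves.SkinnerUrban2014.FittingIdealLemma
import Literature.NumberTheory.EllipticCurves.SkinnerUrban2014.CharacteristicIdealBaseChangeProofs
import Mathlib.RingTheory.LocalRing.MaximalIdeal.Basic
import HarnessLib

/-!
# Skinner–Urban 2014, proofs of Thms. 3.6.5–3.6.6: the transfer of a main conjecture along a
# specialisation ("family divisibility + the main conjecture at ONE point ⟹ the main conjecture
# for the family"), as theorems of commutative algebra

C. Skinner, E. Urban, *The Iwasawa main conjectures for `GL₂`*, Invent. Math. 195 (2014), 1–277
(bib key `SkinnerUrban2014`; held author version `paper:doi-10-1007-s00222-013-0448-1`, whose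
three-level numbering and pages are used in every `[cite:]` of the tree for this source).

**The printed argument** (author version, p. 44, proof of Thm. 3.6.5, verbatim): "Let
`A := 𝒪_L⟦Γ_K⟧` and let `𝔞 ⊂ A` be the kernel of the homomorphism `𝒪_L⟦Γ_K⟧ → 𝒪_L⟦Γ_ℚ⟧`
induced by the canonical projection `Γ_K → Γ_ℚ`. Put `I := Ch^Σ_{K_∞,L}(f)`, `J := Ft^Σ_{K_∞,L}(f)`,
and `L := 𝓛^Σ_{f,K}`. By Corollary 3.6.2, `J ⊆ I ⊆ (L)`. We also have `J mod 𝔞 =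
Ft^Σ_{ℚ_∞,L}(f) Ft^Σ_{ℚ_∞,L}(f ⊗ χ)` by Proposition 3.2.11, and the latter ideal equals
`Ch^Σ_{ℚ_∞,L}(f) Ch^Σ_{ℚ_∞,L}(f ⊗ χ)` by Corollary 3.3.20(iii), and this ideal equals
`(𝓛^Σ_f 𝓛^Σ_{f ⊗ χ_K}) = (L) mod 𝔞` by Theorem 3.6.4. The equalities `J = I = (L)` then follows
from Lemma 3.1.7." And (pp. 44–45, proof of Thm. 3.6.6, the three-variable main conjecture):
"We then let `A := 𝕀⟦Γ_K⟧` and `𝔞 ⊂ A` be the kernel of the homomorphism `𝕀⟦Γ_K⟧ → 𝒪_L[Γ_K]`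
induced by `φ`. Put `J := Ft^Σ_{K_∞}(𝐟)`, `I := Ch^Σ_{K_∞}(𝐟)`, and `L := 𝓛^Σ_{𝐟,K} ∈ A`. Then
`J ⊆ I ⊆ (L)` by Theorem 3.6.1. We also have `J mod 𝔞 = Ft^Σ_{K_∞}(f_φ) = (𝓛^Σ_{f_φ,K}) = (L) mod 𝔞`
by (3.3.12.b) and Theorem 3.6.5. That `J = I = (L)` then follows from Lemma 3.1.7."

So the TRANSFER PRINCIPLE of the paper is the following piece of commutative algebra, with exactly
two arithmetic inputs — (α) a one-sided divisibility for the family, `Fitt_A(X) ⊆ I ⊆ (L)` (`I` the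
characteristic ideal; Thm. 3.6.1 / Cor. 3.6.2), and (β) the two-sided equality AT ONE POINT in
Fitting-ideal form, `Fitt_{A/𝔞}(X/𝔞X) = (L mod 𝔞)` (control (3.3.12.b) / Prop. 3.2.11, `Fitt = Char`
at the point Cor. 3.3.20 (iii), and the main conjecture at the point Thm. 3.6.4 / 3.6.5):

> Let `A` be a commutative ring, `𝔞 ⊆ Jac(A)` an ideal with `A/𝔞` a domain, `X` a finite
> `A`-module, `L ∈ A` with `L mod 𝔞 ≠ 0`, and `I` an ideal with `Fitt_A(X) ⊆ I ⊆ (L)`. If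
> `Fitt_{A/𝔞}(X/𝔞X) = (L mod 𝔞)`, then `Fitt_A(X) = I = (L)`.

Proof, as printed: Fitting ideals commute with base change (§3.1.6 / Cor. 3.2.9 (i), the tree's
`SkinnerUrban2014.fittingIdeal_quotient_baseChange`), so `L mod 𝔞 ∈ Fitt_A(X) mod 𝔞`, and
Lemma 3.1.7 (tree: `SkinnerUrban2014.eq_span_singleton_of_le_of_le_of_mem_map`) gives
`Fitt_A(X) = I = (L)`. This file PROVES the principle in that generality
(`fittingIdeal_zero_eq_span_of_specialization`), in the form with S–U's three labelled inputs
(`…_of_fittingIdeal_eq_charIdeal`), with `I` the tree's characteristic ideal over a Noetherian UFD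
(`charIdeal_eq_span_of_specialization`, using §3.1.6 `Fitt ⊆ Char`, tree
`fittingIdeal_zero_le_charIdeal`), over a LOCAL ring where "`𝔞 ⊆ Jac(A)`" is automatic for every
`𝔞` with `A/𝔞` a domain (`…_of_isLocalRing`; `𝒪_L⟦Γ_K⟧`, `𝕀⟦Γ_K⟧`, `Λ` are local), and for the
Iwasawa algebra `Λ = ℤ_p⟦T⟧` (`iwasawaAlgebra_charIdeal_eq_span_of_specialization`: "`Ch_Λ(X) ⊆ (L)`
and `Fitt_{Λ/𝔞}(X/𝔞X) = (L mod 𝔞)`, `L ∉ 𝔞` ⟹ `Ch_Λ(X) = Fitt_Λ(X) = (L)`", for any ideal `𝔞` with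
`Λ/𝔞` a domain, e.g. `𝔞 = (T)` with `Λ/(T) = ℤ_p`, or `𝔞 = (T − u)`, `u ∈ pℤ_p`).

What the principle does NOT supply (recorded for the cell `b2b-bsdres`, seat x11a GEN 21, which
named this transfer as the "integral-anchor route" for the residual class X11a): input (β), an
INTEGRAL two-sided equality at one arithmetic point of the family — in Skinner–Urban it comes from
Thm. 3.6.4 under (irred) + (ram) + an `SL₂(ℤ_p)`-image hypothesis; the transfer itself is
hypothesis-free algebra.

Theorems only (no `def`, no named fact; D-0014/D-0026). Namespace
`Literature.NumberTheory.EllipticCurves.SkinnerUrban2014`.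

## References

* C. Skinner, E. Urban, Invent. Math. 195 (2014): Lemma 3.1.7 (p. 20), §3.1.6 (pp. 19–20),
  Cor. 3.2.9 (p. 24), Cor. 3.3.20 (iii) (p. 36), proofs of Thm. 3.6.5 (p. 44) and Thm. 3.6.6
  (pp. 44–45). [SkinnerUrban2014]
* L. C. Washington, *Introduction to Cyclotomic Fields*, 2nd ed., GTM 83, §13.2 (the prime `(T)` of
  `Λ`; `Λ` local). [Washington1997]
-/

noncomputable section

open scoped TensorProduct

open Literature.RingTheory.FittingIdeal Literature.NumberTheory.EllipticCurves
  Literature.NumberTheory.EllipticCurves.Module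

namespace Literature.NumberTheory.EllipticCurves.SkinnerUrban2014

universe u v

variable {A : Type u} [CommRing A]

/-! ### The transfer principle over a general commutative ring -/

/-- **Skinner–Urban's transfer of a main conjecture along a specialisation** (the proof of
Thms. 3.6.5 / 3.6.6, as commutative algebra). Let `𝔞 ⊆ Jac(A)` with `A/𝔞` a domain, `X` a finite
`A`-module, `L ∈ A` with `L̄ := L mod 𝔞 ≠ 0`, and `I` an ideal with `J := Fitt_A(X) ⊆ I ⊆ (L)`
("`J ⊆ I ⊆ (L)` by Corollary 3.6.2 / Theorem 3.6.1" — the one-sided divisibility for the family).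
If `Fitt_{A/𝔞}(X/𝔞X) = (L̄)` (the two-sided equality at the point `𝔞`, in Fitting form), then
`J = (L)` and `I = (L)`: "`J mod 𝔞 = … = (L) mod 𝔞 … The equalities `J = I = (L)` then follows from
Lemma 3.1.7" (`X/𝔞X = (A/𝔞) ⊗_A X`; `Fitt_{A/𝔞}(X/𝔞X) = Fitt_A(X) mod 𝔞` is §3.1.6 / Cor. 3.2.9 (i)).
[cite: SkinnerUrban2014, proof of Thm. 3.6.5 (p. 44), proof of Thm. 3.6.6 (pp. 44–45), Lemma 3.1.7 (p. 20)] -/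
theorem fittingIdeal_zero_eq_span_of_specialization {𝔞 : Ideal A}
    (h𝔞 : 𝔞 ≤ (⊥ : Ideal A).jacobson) [IsDomain (A ⧸ 𝔞)]
    {X : Type v} [AddCommGroup X] [Module A X] [Module.Finite A X]
    {L : A} (hL : Ideal.Quotient.mk 𝔞 L ≠ 0)
    {I : Ideal A} (hJI : Module.fittingIdeal A X 0 ≤ I) (hI : I ≤ Ideal.span {L})
    (hpt : Module.fittingIdeal (A ⧸ 𝔞) ((A ⧸ 𝔞) ⊗[A] X) 0 =
      Ideal.span {Ideal.Quotient.mk 𝔞 L}) :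
    Module.fittingIdeal A X 0 = Ideal.span {L} ∧ I = Ideal.span {L} := by
  -- `L̄ ∈ J mod 𝔞`, since `J mod 𝔞 = Fitt_{A/𝔞}(X/𝔞X) = (L̄)`
  have hLJ : Ideal.Quotient.mk 𝔞 L ∈ (Module.fittingIdeal A X 0).map (Ideal.Quotient.mk 𝔞) := by
    rw [← fittingIdeal_quotient_baseChange 𝔞 X 0, hpt]
    exact Ideal.mem_span_singleton_self _
  exact eq_span_singleton_of_le_of_le_of_mem_map h𝔞 hL hJI hI hLJ

/-- **The transfer with Skinner–Urban's three labelled inputs at the point.** As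
`fittingIdeal_zero_eq_span_of_specialization`, with the equality at the point assembled exactly as on
p. 44: `Fitt_{A/𝔞}(X/𝔞X) = Ch` ("by Corollary 3.3.20(iii)", the equality of Fitting and
characteristic ideals at the point — here `Ch` is any ideal of `A/𝔞`) and `Ch = (L̄)` ("by Theorem
3.6.4", the main conjecture at the point).
[cite: SkinnerUrban2014, proof of Thm. 3.6.5 (p. 44), Cor. 3.3.20 (iii) (p. 36)] -/
theorem fittingIdeal_zero_eq_span_of_specialization_of_fittingIdeal_eq_charIdeal {𝔞 : Ideal A}
    (h𝔞 : 𝔞 ≤ (⊥ : Ideal A).jacobson) [IsDomain (A ⧸ 𝔞)]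
    {X : Type v} [AddCommGroup X] [Module A X] [Module.Finite A X]
    {L : A} (hL : Ideal.Quotient.mk 𝔞 L ≠ 0)
    {I : Ideal A} (hJI : Module.fittingIdeal A X 0 ≤ I) (hI : I ≤ Ideal.span {L})
    {Ch : Ideal (A ⧸ 𝔞)} (hFC : Module.fittingIdeal (A ⧸ 𝔞) ((A ⧸ 𝔞) ⊗[A] X) 0 = Ch)
    (hMC : Ch = Ideal.span {Ideal.Quotient.mk 𝔞 L}) :
    Module.fittingIdeal A X 0 = Ideal.span {L} ∧ I = Ideal.span {L} :=
  fittingIdeal_zero_eq_span_of_specialization h𝔞 hL hJI hI (hFC.trans hMC)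

/-- In a local ring every ideal `𝔞` with `A/𝔞` a domain (indeed every proper ideal) lies in the
Jacobson radical, which is the maximal ideal: the hypothesis "`𝔞 ⊂ A` a proper ideal contained in
the Jacobson radical of `A`" of Lemma 3.1.7 is automatic for the local rings `𝒪_L⟦Γ_K⟧`, `𝕀⟦Γ_K⟧`
of Thms. 3.6.5–3.6.6. [cite: SkinnerUrban2014, Lemma 3.1.7 (p. 20)] -/
theorem le_jacobson_bot_of_isLocalRing [IsLocalRing A] (𝔞 : Ideal A) [Nontrivial (A ⧸ 𝔞)] :
    𝔞 ≤ (⊥ : Ideal A).jacobson := by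
  have h𝔞 : 𝔞 ≠ ⊤ := Ideal.Quotient.nontrivial_iff.mp inferInstance
  rw [IsLocalRing.jacobson_eq_maximalIdeal ⊥ bot_ne_top]
  exact IsLocalRing.le_maximalIdeal h𝔞

/-- **The transfer over a local ring** (no Jacobson-radical hypothesis): `A` local, `A/𝔞` a
domain, `Fitt_A(X) ⊆ I ⊆ (L)`, `L ∉ 𝔞`, `Fitt_{A/𝔞}(X/𝔞X) = (L̄)` ⟹ `Fitt_A(X) = I = (L)`.
[cite: SkinnerUrban2014, proof of Thm. 3.6.5 (p. 44), proof of Thm. 3.6.6 (pp. 44–45)] -/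
theorem fittingIdeal_zero_eq_span_of_specialization_of_isLocalRing [IsLocalRing A]
    (𝔞 : Ideal A) [IsDomain (A ⧸ 𝔞)]
    {X : Type v} [AddCommGroup X] [Module A X] [Module.Finite A X]
    {L : A} (hL : L ∉ 𝔞)
    {I : Ideal A} (hJI : Module.fittingIdeal A X 0 ≤ I) (hI : I ≤ Ideal.span {L})
    (hpt : Module.fittingIdeal (A ⧸ 𝔞) ((A ⧸ 𝔞) ⊗[A] X) 0 =
      Ideal.span {Ideal.Quotient.mk 𝔞 L}) :
    Module.fittingIdeal A X 0 = Ideal.span {L} ∧ I = Ideal.span {L} :=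
  fittingIdeal_zero_eq_span_of_specialization (le_jacobson_bot_of_isLocalRing 𝔞)
    (fun h => hL (Ideal.Quotient.eq_zero_iff_mem.mp h)) hJI hI hpt

/-! ### The transfer for the characteristic ideal (Noetherian UFD: `Fitt ⊆ Char`, §3.1.6) -/

section UFD

variable [IsNoetherianRing A] [IsDomain A] [UniqueFactorizationMonoid A]
  {X : Type v} [AddCommGroup X] [Module A X] [Module.Finite A X]

/-- **The transfer for characteristic ideals.** Let `A` be a Noetherian unique factorization domain
(so that `Fitt_A(X) ⊆ Char_A(X)`, §3.1.6, tree `fittingIdeal_zero_le_charIdeal`), `𝔞 ⊆ Jac(A)` with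
`A/𝔞` a domain, `X` a finite `A`-module and `L ∈ A`, `L ∉ 𝔞`. If `Char_A(X) ⊆ (L)` (ONE
divisibility for the family: "`J ⊆ I ⊆ (L)`") and `Fitt_{A/𝔞}(X/𝔞X) = (L mod 𝔞)` (the main
conjecture at the point `𝔞`, Fitting form), then `Fitt_A(X) = (L)` and `Char_A(X) = (L)` — the main
conjecture for the family ("`J = I = (L)`").
[cite: SkinnerUrban2014, proof of Thm. 3.6.5 (p. 44), proof of Thm. 3.6.6 (pp. 44–45), §3.1.6 (p. 20)] -/
theorem charIdeal_eq_span_of_specialization {𝔞 : Ideal A}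
    (h𝔞 : 𝔞 ≤ (⊥ : Ideal A).jacobson) [IsDomain (A ⧸ 𝔞)]
    {L : A} (hL : Ideal.Quotient.mk 𝔞 L ≠ 0) (hdiv : charIdeal A X ≤ Ideal.span {L})
    (hpt : Module.fittingIdeal (A ⧸ 𝔞) ((A ⧸ 𝔞) ⊗[A] X) 0 =
      Ideal.span {Ideal.Quotient.mk 𝔞 L}) :
    Module.fittingIdeal A X 0 = Ideal.span {L} ∧ charIdeal A X = Ideal.span {L} :=
  fittingIdeal_zero_eq_span_of_specialization h𝔞 hL (fittingIdeal_zero_le_charIdeal (M := X))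
    hdiv hpt

omit [IsNoetherianRing A] [IsDomain A] [UniqueFactorizationMonoid A] in
/-- **The transfer for characteristic ideals over a LOCAL Noetherian UFD** (`𝒪⟦T⟧`, `ℤ_p⟦T₁, T₂⟧`,
…): for every ideal `𝔞` with `A/𝔞` a domain, `Char_A(X) ⊆ (L)`, `L ∉ 𝔞` and
`Fitt_{A/𝔞}(X/𝔞X) = (L mod 𝔞)` imply `Fitt_A(X) = Char_A(X) = (L)`.
[cite: SkinnerUrban2014, proof of Thm. 3.6.5 (p. 44), proof of Thm. 3.6.6 (pp. 44–45)] -/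
theorem charIdeal_eq_span_of_specialization_of_isLocalRing [IsNoetherianRing A] [IsDomain A]
    [UniqueFactorizationMonoid A] [IsLocalRing A] (𝔞 : Ideal A) [IsDomain (A ⧸ 𝔞)]
    {L : A} (hL : L ∉ 𝔞) (hdiv : charIdeal A X ≤ Ideal.span {L})
    (hpt : Module.fittingIdeal (A ⧸ 𝔞) ((A ⧸ 𝔞) ⊗[A] X) 0 =
      Ideal.span {Ideal.Quotient.mk 𝔞 L}) :
    Module.fittingIdeal A X 0 = Ideal.span {L} ∧ charIdeal A X = Ideal.span {L} :=
  charIdeal_eq_span_of_specialization (le_jacobson_bot_of_isLocalRing 𝔞)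
    (fun h => hL (Ideal.Quotient.eq_zero_iff_mem.mp h)) hdiv hpt

/-- The conclusion `Char_A(X) = (L)` of the transfer makes the two ideals of the family coincide:
`Fitt_A(X) = Char_A(X)` ("`J = I`"). [cite: SkinnerUrban2014, Thm. 3.6.5 / Thm. 3.6.6 (p. 44),
conclusion "`Ft^Σ = Ch^Σ = (𝓛)`"] -/
theorem fittingIdeal_zero_eq_charIdeal_of_specialization {𝔞 : Ideal A}
    (h𝔞 : 𝔞 ≤ (⊥ : Ideal A).jacobson) [IsDomain (A ⧸ 𝔞)]
    {L : A} (hL : Ideal.Quotient.mk 𝔞 L ≠ 0) (hdiv : charIdeal A X ≤ Ideal.span {L})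
    (hpt : Module.fittingIdeal (A ⧸ 𝔞) ((A ⧸ 𝔞) ⊗[A] X) 0 =
      Ideal.span {Ideal.Quotient.mk 𝔞 L}) :
    Module.fittingIdeal A X 0 = charIdeal A X := by
  obtain ⟨hJ, hI⟩ := charIdeal_eq_span_of_specialization (X := X) h𝔞 hL hdiv hpt
  rw [hJ, hI]

end UFD

/-! ### The transfer for the Iwasawa algebra `Λ = ℤ_p⟦T⟧` -/

section Iwasawa

variable (p : ℕ) [Fact p.Prime]

/-- **The transfer along a specialisation of `Λ = ℤ_p⟦T⟧`.** `Λ` is a local Noetherian unique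
factorization domain, so for ANY ideal `𝔞` with `Λ/𝔞` a domain (`𝔞 = (T)`, `Λ/(T) ≅ ℤ_p`, the
cyclotomic base point; `𝔞 = (T − u)`, `u ∈ pℤ_p`, another point of the open disc; `𝔞 = (p)`), a
finitely generated `Λ`-module `X` and `L ∈ Λ ∖ 𝔞`: ONE divisibility `Ch_Λ(X) ⊆ (L)` over `Λ`
together with the EQUALITY `Fitt_{Λ/𝔞}(X/𝔞X) = (L mod 𝔞)` at the point give
`Fitt_Λ(X) = Ch_Λ(X) = (L)` (Skinner–Urban's Lemma 3.1.7 mechanism, proofs of Thms. 3.6.5–3.6.6).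
At `𝔞 = (T)`, with `X` the dual Selmer group of an elliptic curve over `ℚ_∞` and `L` its `p`-adic
`L`-function, the two inputs read: Kato's divisibility, and "`#(X/TX) = |L(0)|_p⁻¹`" (the order of a
finite `ℤ_p`-module generates its Fitting ideal) — control plus the `p`-part of the Birch and
Swinnerton-Dyer formula at the base; the output is the main conjecture for `E`.
[cite: SkinnerUrban2014, proof of Thm. 3.6.5 (p. 44), proof of Thm. 3.6.6 (pp. 44–45), Lemma 3.1.7 (p. 20)]
[cite: Washington1997, §13.2] -/
theorem iwasawaAlgebra_charIdeal_eq_span_of_specialization (𝔞 : Ideal (IwasawaAlgebra p))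
    [IsDomain (IwasawaAlgebra p ⧸ 𝔞)]
    (X : Type v) [AddCommGroup X] [Module (IwasawaAlgebra p) X] [Module.Finite (IwasawaAlgebra p) X]
    {L : IwasawaAlgebra p} (hL : L ∉ 𝔞)
    (hdiv : charIdeal (IwasawaAlgebra p) X ≤ Ideal.span {L})
    (hpt : Module.fittingIdeal (IwasawaAlgebra p ⧸ 𝔞) ((IwasawaAlgebra p ⧸ 𝔞) ⊗[IwasawaAlgebra p] X) 0
      = Ideal.span {Ideal.Quotient.mk 𝔞 L}) :
    Module.fittingIdeal (IwasawaAlgebra p) X 0 = Ideal.span {L} ∧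
      charIdeal (IwasawaAlgebra p) X = Ideal.span {L} :=
  charIdeal_eq_span_of_specialization_of_isLocalRing (X := X) 𝔞 hL hdiv hpt

/-- **The transfer at the cyclotomic base point `T ↦ 0`** (`𝔞 = (T)`, `Λ/(T) ≅ ℤ_p` a domain —
tree `isDomain_quotient_span_X`): `Ch_Λ(X) ⊆ (L)`, `L ∉ (T)` (i.e. `L(0) ≠ 0`) and
`Fitt_{Λ/(T)}(X/TX) = (L mod T)` imply `Fitt_Λ(X) = Ch_Λ(X) = (L)`.
[cite: SkinnerUrban2014, proof of Thm. 3.6.5 (p. 44), Lemma 3.1.7 (p. 20)] [cite: Washington1997, §13.2] -/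
theorem iwasawaAlgebra_charIdeal_eq_span_of_specialization_span_X
    (X : Type v) [AddCommGroup X] [Module (IwasawaAlgebra p) X] [Module.Finite (IwasawaAlgebra p) X]
    {L : IwasawaAlgebra p} (hL : L ∉ Ideal.span {(PowerSeries.X : IwasawaAlgebra p)})
    (hdiv : charIdeal (IwasawaAlgebra p) X ≤ Ideal.span {L})
    (hpt : Module.fittingIdeal (IwasawaAlgebra p ⧸ Ideal.span {(PowerSeries.X : IwasawaAlgebra p)})
        ((IwasawaAlgebra p ⧸ Ideal.span {(PowerSeries.X : IwasawaAlgebra p)})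
          ⊗[IwasawaAlgebra p] X) 0 =
      Ideal.span {Ideal.Quotient.mk (Ideal.span {(PowerSeries.X : IwasawaAlgebra p)}) L}) :
    Module.fittingIdeal (IwasawaAlgebra p) X 0 = Ideal.span {L} ∧
      charIdeal (IwasawaAlgebra p) X = Ideal.span {L} := by
  haveI := isDomain_quotient_span_X p
  exact iwasawaAlgebra_charIdeal_eq_span_of_specialization p _ X hL hdiv hpt

end Iwasawa

end Literature.NumberTheory.EllipticCurves.SkinnerUrban2014

end
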